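import Literature.MathematicalPhysics.QuantumManyBody.TorusSlotShiftDirichlet
import Literature.MathematicalPhysics.QuantumManyBody.PeriodicBoseGasImpurity
import HarnessLib

/-!
# Diagonal translations on `L²((ℝ/ℤ)^{3N})`: invariance of the maximal form and the zero-momentum modes

Topic `Literature/MathematicalPhysics/QuantumManyBody`, sequel of `PeriodicMaxFormGroundStates.lean` (maximal
form of the periodic `N`-body Hamiltonian on `L²((ℝ/ℤ)^{3N})`, Haar probability measure) and of
`TorusSlotShiftDirichlet.lean` (one-slot shifts). The torus `(ℝ/ℤ)³` acts on `L²((ℝ/ℤ)^{3N})` by the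
DIAGONAL translations `(T_b η)(t) = η(t + (b, …, b))` (all `N` particles moved by the same `b`); in Fourier
space `⟪eₙ, T_b η⟫ = e_{∑ᵢ n(i,·)}(b) ⟪eₙ, η⟫` (`inner_mFourierLp_translateLp`), the character of the TOTAL
momentum `∑ᵢ n(i,·) ∈ ℤ³` of the frequency `n ∈ (ℤ³)^N`.

* `diagShift b`, `translateLp b : L²((ℝ/ℤ)^{3N}) →ₗᵢ[ℂ] L²((ℝ/ℤ)^{3N})` (Mathlib's
  `Lp.compMeasurePreservingₗᵢ` for the Haar-measure-preserving translation);
* invariance under `T_b` of: the Bose sector (`translateLp_mem_boseSymmetric`), every spectral weight sum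
  `∑ₙ wₙ |⟪eₙ, ·⟫|²` (`tsum_weight_inner_translateLp`; in particular the kinetic part `maxFormKin` and the
  zero-mode depletion weights), the potential part `maxFormPot` (`maxFormPot_translateLp`: the periodic pair
  interaction `W ∘ fromUnitTorusN L` is invariant under diagonal translations), the `L²` norm, and
  `T_b (Φ ∘ η) = Φ ∘ (T_b η)` for Lipschitz maps of the values (`compLp_translateLp`);
* `translateLp_eq_self_iff` — `η` is invariant under all diagonal translations iff its Fourier coefficients
  of non-zero total momentum vanish;
* `integral_inner_translateLp` — the **averaging identity**
  `∫ ⟪ξ, T_b η⟫ db = ∑_{n : ∑ᵢ n(i,·) = 0} conj⟪eₙ, ξ⟫ ⟪eₙ, η⟫` (term-wise integration of Parseval);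
* `exists_invariant_mem_of_isClosed` — hence a CLOSED subspace `V` stable under all `T_b` contains, with
  every `η`, its zero-momentum part `ζ` (`⟪eₙ, ζ⟫ = 𝟙[∑ᵢ n(i,·) = 0] ⟪eₙ, η⟫`; `ζ ∈ Vᗮᗮ = V` by the averaging
  identity), which is translation invariant and has the same mean `⟪e₀, ζ⟫ = ⟪e₀, η⟫`.

Applied to the (closed, translation-invariant) ground-state class of a translation-invariant closed quadratic
form this is the statement "the bottom of the spectrum is attained in the sector of zero total momentum"
without any uniqueness / Perron–Frobenius input: a non-negative ground state `η ≥ 0`, `η ≠ 0`, has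
`⟪e₀, η⟫ = ∫ η > 0`, so its zero-momentum part is a non-zero translation-invariant ground state.

## References

* M. Reed, B. Simon, *Methods of Modern Mathematical Physics IV* (1978), §XIII.16 (direct integral /
  constant-fibre decomposition of translation-invariant operators), §XIII.12. [ReedSimonIV1978]
* H. D. Cornean, J. Dereziński, P. Ziń, J. Math. Phys. 50 (2009) 062103, §1.1 (total momentum of the
  periodic Bose gas). [CorneanDerezinskiZin2009]
-/

noncomputable section

open MeasureTheory Filter Set Complex UnitAddTorus
open scoped ENNReal NNReal Topology InnerProductSpace ComplexConjugate
open Literature.Analysis.FunctionSpaces Literature.Analysis.OperatorTheory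

namespace Literature.MathematicalPhysics.QuantumManyBody.BoseGas

-- The measure on `ℝ/ℤ` is the Haar PROBABILITY measure, as in `PeriodicFormDomain.lean`.
attribute [local instance] formDomain_measureSpace formDomain_isProbabilityMeasure formDomain_isProbabilityMeasure_pi

variable {N : ℕ} {L : ℝ} {v : ℝ → ℝ≥0∞}

/-- Local notation for the Hilbert space `L²((ℝ/ℤ)^{3N})`, as in `PeriodicFormDomain.lean`. -/
local notation "L2T " N':max => Lp ℂ 2 (volume : Measure (UnitAddTorus (Fin N' × Fin 3)))

/-- The measure on `ℝ/ℤ` is a Haar measure. [folklore] -/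
local instance translation_isAddHaarMeasure : Measure.IsAddHaarMeasure (volume : Measure UnitAddCircle) :=
  inferInstanceAs (Measure.IsAddHaarMeasure AddCircle.haarAddCircle)

/-- The Haar product measure on `(ℝ/ℤ)^D` is right invariant. [folklore] -/
local instance translation_isAddRightInvariant {D : Type*} [Fintype D] :
    (volume : Measure (UnitAddTorus D)).IsAddRightInvariant := by
  rw [volume_pi]; infer_instance

/-! ### Diagonal shifts and the total momentum of a frequency -/

/-- The **diagonal shift** `(b, …, b) ∈ (ℝ/ℤ)^{3N}` of `b ∈ (ℝ/ℤ)³` (all particles moved by `b`). [folklore] -/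
def diagShift (N : ℕ) (b : UnitAddTorus (Fin 3)) : UnitAddTorus (Fin N × Fin 3) := fun p => b p.2

/-- Coordinates of the diagonal shift. [folklore] -/
@[simp] theorem diagShift_apply (b : UnitAddTorus (Fin 3)) (p : Fin N × Fin 3) : diagShift N b p = b p.2 := rfl

/-- The diagonal shift is additive. [folklore] -/
theorem diagShift_add (b b' : UnitAddTorus (Fin 3)) : diagShift N (b + b') = diagShift N b + diagShift N b' := rfl

/-- The diagonal shift is continuous. [folklore] -/
theorem continuous_diagShift : Continuous (diagShift N) :=
  continuous_pi fun p => continuous_apply p.2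

/-- Characters of `ℝ/ℤ` at a sum of frequencies. [folklore] -/
theorem fourier_finset_sum_apply {ι : Type*} (s : Finset ι) (m : ι → ℤ) (x : UnitAddCircle) :
    fourier (∑ i ∈ s, m i) x = ∏ i ∈ s, fourier (m i) x := by
  classical
  induction s using Finset.induction_on with
  | empty => simp only [Finset.sum_empty, Finset.prod_empty, fourier_zero]
  | @insert a s ha ih => rw [Finset.sum_insert ha, Finset.prod_insert ha, fourier_add, ih]

/-- **Characters at a diagonal shift**: `eₙ((b,…,b)) = e_{∑ᵢ n(i,·)}(b)`, the character of the total momentum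
of `n`. [folklore] -/
theorem mFourier_diagShift (n : Fin N × Fin 3 → ℤ) (b : UnitAddTorus (Fin 3)) :
    mFourier n (diagShift N b) = mFourier (fun k => ∑ i, n (i, k)) b := by
  simp only [mFourier, ContinuousMap.coe_mk, diagShift_apply]
  rw [Fintype.prod_prod_type_right]
  refine Finset.prod_congr rfl fun k _ => ?_
  dsimp only
  exact (fourier_finset_sum_apply _ _ _).symm

/-- The total momentum of a particle-permuted frequency is unchanged. [folklore] -/
theorem totalMomentum_comp_perm (σ : Equiv.Perm (Fin N)) (n : Fin N × Fin 3 → ℤ) :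
    (fun k => ∑ i, (fun p : Fin N × Fin 3 => n (σ p.1, p.2)) (i, k)) = fun k => ∑ i, n (i, k) := by
  funext k
  exact Equiv.sum_comp σ (fun i => n (i, k))

/-! ### The diagonal translations `T_b` -/

/-- **Diagonal translation** `(T_b η)(t) = η(t + (b,…,b))` on `L²((ℝ/ℤ)^{3N})`, a linear isometry (the Haar
measure is translation invariant). [folklore] -/
def translateLp (b : UnitAddTorus (Fin 3)) : L2T N →ₗᵢ[ℂ] L2T N :=
  Lp.compMeasurePreservingₗᵢ ℂ (fun t => t + diagShift N b) (measurePreserving_add_right volume (diagShift N b))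

/-- The a.e. representative of `T_b η`. [folklore] -/
theorem coeFn_translateLp (b : UnitAddTorus (Fin 3)) (η : L2T N) :
    ((translateLp b η : L2T N) : UnitAddTorus (Fin N × Fin 3) → ℂ) =ᵐ[volume]
      fun t => (η : UnitAddTorus (Fin N × Fin 3) → ℂ) (t + diagShift N b) :=
  Lp.coeFn_compMeasurePreserving η _

/-- `T_b` is isometric. [folklore] -/
theorem norm_translateLp (b : UnitAddTorus (Fin 3)) (η : L2T N) : ‖translateLp b η‖ = ‖η‖ :=
  (translateLp b).norm_map η

/-- **Fourier coefficients of a diagonal translate**: `⟪eₙ, T_b η⟫ = e_{∑ᵢ n(i,·)}(b) ⟪eₙ, η⟫`. [folklore] -/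
theorem inner_mFourierLp_translateLp (n : Fin N × Fin 3 → ℤ) (b : UnitAddTorus (Fin 3)) (η : L2T N) :
    ⟪(mFourierLp 2 n : L2T N), translateLp b η⟫_ℂ =
      mFourier (fun k => ∑ i, n (i, k)) b * ⟪(mFourierLp 2 n : L2T N), η⟫_ℂ := by
  rw [HaarTorus.inner_mFourierLp_eq_mFourierCoeff, HaarTorus.inner_mFourierLp_eq_mFourierCoeff,
    mFourierCoeff_congr_ae (coeFn_translateLp b η) n, mFourierCoeff_comp_add_right, mFourier_diagShift]

/-- The moduli of the Fourier coefficients are translation invariant. [folklore] -/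
theorem nnnorm_inner_mFourierLp_translateLp (n : Fin N × Fin 3 → ℤ) (b : UnitAddTorus (Fin 3)) (η : L2T N) :
    ‖⟪(mFourierLp 2 n : L2T N), translateLp b η⟫_ℂ‖₊ = ‖⟪(mFourierLp 2 n : L2T N), η⟫_ℂ‖₊ := by
  rw [inner_mFourierLp_translateLp, nnnorm_mul, ← NNReal.coe_inj, NNReal.coe_mul, coe_nnnorm,
    Torus.norm_mFourier_apply, one_mul]

/-- **Every spectral weight sum is translation invariant**: `∑ₙ wₙ |⟪eₙ, T_b η⟫|² = ∑ₙ wₙ |⟪eₙ, η⟫|²`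
(kinetic energy, zero-mode depletion, Sobolev seminorms, …). [folklore] -/
theorem tsum_weight_inner_translateLp (w : (Fin N × Fin 3 → ℤ) → ℝ≥0∞) (b : UnitAddTorus (Fin 3)) (η : L2T N) :
    ∑' n : Fin N × Fin 3 → ℤ, w n * ((‖⟪(mFourierLp 2 n : L2T N), translateLp b η⟫_ℂ‖₊ : ℝ≥0∞)) ^ 2 =
      ∑' n : Fin N × Fin 3 → ℤ, w n * ((‖⟪(mFourierLp 2 n : L2T N), η⟫_ℂ‖₊ : ℝ≥0∞)) ^ 2 :=
  tsum_congr fun n => by rw [nnnorm_inner_mFourierLp_translateLp]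

/-- The kinetic part of the maximal form is translation invariant. [folklore] -/
theorem maxFormKin_translateLp (L : ℝ) (b : UnitAddTorus (Fin 3)) (η : L2T N) :
    maxFormKin L (translateLp b η) = maxFormKin L η :=
  tsum_weight_inner_translateLp _ b η

/-- **Translates stay in the Bose sector** (the total momentum, hence the character `e_{∑ᵢ n(i,·)}(b)`, is
invariant under particle permutations). [folklore] -/
theorem translateLp_mem_boseSymmetric (b : UnitAddTorus (Fin 3)) {η : L2T N} (hη : η ∈ boseSymmetric N) :
    translateLp b η ∈ boseSymmetric N := by
  intro σ n
  rw [inner_mFourierLp_translateLp, inner_mFourierLp_translateLp, hη σ n, totalMomentum_comp_perm]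

/-! ### Invariance of the potential part -/

/-- A lattice translation of all particles leaves the periodic pair interaction unchanged. [folklore] -/
theorem periodicInteraction_add_latticeVecN (v : ℝ → ℝ≥0∞) (L : ℝ) (X : Config N) (m : Fin N → Fin 3 → ℤ) :
    periodicInteraction v L (X + latticeVecN L m) = periodicInteraction v L X := by
  unfold periodicInteraction
  refine Finset.sum_congr rfl fun i _ => Finset.sum_congr rfl fun j _ => ?_
  have h : (X + latticeVecN L m) i - (X + latticeVecN L m) j = X i - X j + latticeVec L (m i - m j) := by
    have hsub : latticeVec L (m i - m j) = latticeVec L (m i) - latticeVec L (m j) := by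
      ext k
      simp only [latticeVec, PiLp.toLp_apply, Pi.sub_apply, Int.cast_sub, mul_sub, PiLp.sub_apply]
    rw [hsub]
    simp only [Pi.add_apply, latticeVecN]
    abel
  rw [h, periodizedPotential_add_latticeVec]

/-- **The transported interaction is invariant under diagonal translations**:
`W(fromUnitTorusN L (t + (b,…,b))) = W(fromUnitTorusN L t)` (`W = ∑_{i<j} v^per(xᵢ - xⱼ)` is periodic and
depends on differences only). [folklore] -/
theorem periodicInteraction_fromUnitTorusN_add_diagShift (hL : 0 < L) (v : ℝ → ℝ≥0∞) (b : UnitAddTorus (Fin 3))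
    (t : UnitAddTorus (Fin N × Fin 3)) :
    periodicInteraction v L (fromUnitTorusN L (t + diagShift N b)) = periodicInteraction v L (fromUnitTorusN L t) := by
  set H : Config N := fun _ => fromUnitTorus L b with hH
  have hHt : toUnitTorusN L H = diagShift N b := by
    funext p
    have := congrFun (toUnitTorus_fromUnitTorus hL.ne' b) p.2
    simpa [toUnitTorusN, hH] using this
  have hX : t + diagShift N b = toUnitTorusN L (fromUnitTorusN L t + H) := by
    rw [toUnitTorusN_add, toUnitTorusN_fromUnitTorusN hL.ne', hHt]
  obtain ⟨m, hm⟩ := exists_fromUnitTorusN_toUnitTorusN_eq hL (fromUnitTorusN L t + H)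
  rw [hX, hm, periodicInteraction_add_latticeVecN, hH, periodicInteraction_add_const]

/-- **Weighted `L²` masses with a translation-invariant weight are translation invariant**:
`∫ W |T_b η|² = ∫ W |η|²` if `W(t + (b,…,b)) = W(t)`. [folklore] -/
theorem lintegral_weight_translateLp_eq {W : UnitAddTorus (Fin N × Fin 3) → ℝ≥0∞} (b : UnitAddTorus (Fin 3))
    (hW : ∀ t, W (t + diagShift N b) = W t) (η : L2T N) :
    ∫⁻ t, W t * ((‖((translateLp b η : L2T N) : UnitAddTorus (Fin N × Fin 3) → ℂ) t‖₊ : ℝ≥0∞)) ^ 2 =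
      ∫⁻ t, W t * ((‖(η : UnitAddTorus (Fin N × Fin 3) → ℂ) t‖₊ : ℝ≥0∞)) ^ 2 := by
  calc ∫⁻ t, W t * ((‖((translateLp b η : L2T N) : UnitAddTorus (Fin N × Fin 3) → ℂ) t‖₊ : ℝ≥0∞)) ^ 2
      = ∫⁻ t, W (t + diagShift N b) *
          ((‖(η : UnitAddTorus (Fin N × Fin 3) → ℂ) (t + diagShift N b)‖₊ : ℝ≥0∞)) ^ 2 :=
        lintegral_congr_ae ((coeFn_translateLp b η).mono fun t ht => by
          dsimp only
          rw [ht, hW t])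
    _ = ∫⁻ t, W t * ((‖(η : UnitAddTorus (Fin N × Fin 3) → ℂ) t‖₊ : ℝ≥0∞)) ^ 2 :=
        lintegral_add_right_eq_self
          (fun t => W t * ((‖(η : UnitAddTorus (Fin N × Fin 3) → ℂ) t‖₊ : ℝ≥0∞)) ^ 2) (diagShift N b)

/-- **The potential part of the maximal form is translation invariant.** [folklore] -/
theorem maxFormPot_translateLp (hL : 0 < L) (v : ℝ → ℝ≥0∞) (b : UnitAddTorus (Fin 3)) (η : L2T N) :
    maxFormPot v L (translateLp b η) = maxFormPot v L η :=
  lintegral_weight_translateLp_eq b (periodicInteraction_fromUnitTorusN_add_diagShift hL v b) η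

/-- **The maximal form is translation invariant.** [folklore] -/
theorem maxForm_translateLp (hL : 0 < L) (v : ℝ → ℝ≥0∞) (b : UnitAddTorus (Fin 3)) (η : L2T N) :
    maxForm v L (translateLp b η) = maxForm v L η := by
  rw [maxForm, maxForm, maxFormKin_translateLp, maxFormPot_translateLp hL]

/-! ### Translations commute with maps of the values -/

/-- **`T_b (Φ ∘ η) = Φ ∘ T_b η`** for a Lipschitz `Φ : ℂ → ℂ` with `Φ 0 = 0`. [folklore] -/
theorem compLp_translateLp {Φ : ℂ → ℂ} {K : ℝ≥0} (hΦ : LipschitzWith K Φ) (h0 : Φ 0 = 0) (b : UnitAddTorus (Fin 3))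
    (η : L2T N) : hΦ.compLp h0 (translateLp b η) = translateLp b (hΦ.compLp h0 η) := by
  apply Lp.ext
  have h1 := hΦ.coeFn_compLp h0 (translateLp b η)
  have h2 := coeFn_translateLp b (hΦ.compLp h0 η : L2T N)
  have h3 : ∀ᵐ t ∂(volume : Measure (UnitAddTorus (Fin N × Fin 3))),
      ((hΦ.compLp h0 η : L2T N) : UnitAddTorus (Fin N × Fin 3) → ℂ) (t + diagShift N b) =
        Φ ((η : UnitAddTorus (Fin N × Fin 3) → ℂ) (t + diagShift N b)) := by
    have h := (measurePreserving_add_right (volume : Measure (UnitAddTorus (Fin N × Fin 3)))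
      (diagShift N b)).quasiMeasurePreserving.ae_eq_comp (hΦ.coeFn_compLp h0 η)
    filter_upwards [h] with t ht
    simpa only [Function.comp_apply] using ht
  filter_upwards [h1, h2, h3, coeFn_translateLp b η] with t ht1 ht2 ht3 ht4
  rw [ht1, Function.comp_apply, ht4, ht2, ht3]

/-- `T_b |η| = |T_b η|`. [folklore] -/
theorem absLp_translateLp (b : UnitAddTorus (Fin 3)) (η : L2T N) : absLp (translateLp b η) = translateLp b (absLp η) :=
  compLp_translateLp _ _ b η

/-! ### Translation invariance and the zero-momentum modes -/

/-- **`η` is invariant under all diagonal translations iff its Fourier coefficients of non-zero total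
momentum vanish.** [folklore] -/
theorem translateLp_eq_self_iff (η : L2T N) :
    (∀ b : UnitAddTorus (Fin 3), translateLp b η = η) ↔
      ∀ n : Fin N × Fin 3 → ℤ, (fun k => ∑ i, n (i, k)) ≠ 0 → ⟪(mFourierLp 2 n : L2T N), η⟫_ℂ = 0 := by
  constructor
  · intro h n hn
    -- integrate `⟪eₙ, η⟫ = ⟪eₙ, T_b η⟫ = e_m(b) ⟪eₙ, η⟫` over `b`: `∫ e_m = 0`
    have hb : ∀ b, mFourier (fun k => ∑ i, n (i, k)) b * ⟪(mFourierLp 2 n : L2T N), η⟫_ℂ =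
        ⟪(mFourierLp 2 n : L2T N), η⟫_ℂ := fun b => by rw [← inner_mFourierLp_translateLp, h b]
    have hint := congrArg (fun F : UnitAddTorus (Fin 3) → ℂ => ∫ b, F b) (funext hb)
    simp only [integral_mul_const, integral_const, probReal_univ, one_smul, integral_mFourier_eq_ite, if_neg hn,
      zero_mul] at hint
    exact hint.symm
  · intro h b
    refine Lp_eq_of_forall_inner_mFourierLp_eq fun n => ?_
    rw [inner_mFourierLp_translateLp]
    by_cases hn : (fun k => ∑ i, n (i, k)) = 0
    · rw [hn, mFourier_zero, ContinuousMap.one_apply, one_mul]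
    · rw [h n hn, mul_zero]

/-- Parseval summability of `∑ₙ |⟪eₙ, ξ⟫| |⟪eₙ, η⟫|`. [folklore] -/
theorem summable_norm_inner_mul_inner (ξ η : L2T N) :
    Summable fun n : Fin N × Fin 3 → ℤ => ‖conj ⟪(mFourierLp 2 n : L2T N), ξ⟫_ℂ * ⟪(mFourierLp 2 n : L2T N), η⟫_ℂ‖ := by
  refine Summable.of_nonneg_of_le (fun n => norm_nonneg _) (fun n => ?_)
    ((HaarTorus.hasSum_sq_norm_inner_mFourierLp ξ).summable.add (HaarTorus.hasSum_sq_norm_inner_mFourierLp η).summable)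
  rw [norm_mul, Complex.norm_conj]
  nlinarith [sq_nonneg (‖⟪(mFourierLp 2 n : L2T N), ξ⟫_ℂ‖ - ‖⟪(mFourierLp 2 n : L2T N), η⟫_ℂ‖),
    norm_nonneg ⟪(mFourierLp 2 n : L2T N), ξ⟫_ℂ, norm_nonneg ⟪(mFourierLp 2 n : L2T N), η⟫_ℂ]

/-- Parseval, polarised: `⟪ξ, η⟫ = ∑ₙ conj⟪eₙ, ξ⟫ ⟪eₙ, η⟫`. [folklore] -/
theorem hasSum_conj_inner_mul_inner (ξ η : L2T N) :
    HasSum (fun n : Fin N × Fin 3 → ℤ => conj ⟪(mFourierLp 2 n : L2T N), ξ⟫_ℂ * ⟪(mFourierLp 2 n : L2T N), η⟫_ℂ)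
      ⟪ξ, η⟫_ℂ := by
  have h := mFourierBasis.hasSum_inner_mul_inner ξ η
  simp only [coe_mFourierBasis] at h
  refine h.congr_fun fun n => ?_
  rw [inner_conj_symm]

/-- **The averaging identity**: `∫ ⟪ξ, T_b η⟫ db = ∑_{n : ∑ᵢ n(i,·) = 0} conj⟪eₙ, ξ⟫ ⟪eₙ, η⟫` — averaging the
diagonal translates over the torus projects onto the modes of zero total momentum. [folklore] -/
theorem integral_inner_translateLp (ξ η : L2T N) :
    ∫ b, ⟪ξ, translateLp b η⟫_ℂ = ∑' n : Fin N × Fin 3 → ℤ,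
      if (fun k => ∑ i, n (i, k)) = 0 then conj ⟪(mFourierLp 2 n : L2T N), ξ⟫_ℂ * ⟪(mFourierLp 2 n : L2T N), η⟫_ℂ
      else 0 := by
  set c : (Fin N × Fin 3 → ℤ) → ℂ := fun n => conj ⟪(mFourierLp 2 n : L2T N), ξ⟫_ℂ * ⟪(mFourierLp 2 n : L2T N), η⟫_ℂ
    with hc
  have hcs : Summable fun n => ‖c n‖ := summable_norm_inner_mul_inner ξ η
  -- pointwise Parseval
  have hpt : ∀ b, ⟪ξ, translateLp b η⟫_ℂ = ∑' n : Fin N × Fin 3 → ℤ, mFourier (fun k => ∑ i, n (i, k)) b * c n := by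
    intro b
    rw [← (hasSum_conj_inner_mul_inner ξ (translateLp b η)).tsum_eq]
    refine tsum_congr fun n => ?_
    rw [inner_mFourierLp_translateLp, hc]
    ring
  simp_rw [hpt]
  have hcont : ∀ n : Fin N × Fin 3 → ℤ, Continuous fun b : UnitAddTorus (Fin 3) =>
      mFourier (fun k => ∑ i, n (i, k)) b * c n := fun n => (map_continuous (mFourier _)).mul continuous_const
  rw [integral_tsum (fun n => (hcont n).aestronglyMeasurable)]
  · refine tsum_congr fun n => ?_
    rw [integral_mul_const, integral_mFourier_eq_ite]
    split_ifs
    · rw [one_mul]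
    · rw [zero_mul]
  · have hb : ∀ n : Fin N × Fin 3 → ℤ, ∫⁻ b : UnitAddTorus (Fin 3), ‖mFourier (fun k => ∑ i, n (i, k)) b * c n‖ₑ =
        ENNReal.ofReal ‖c n‖ := fun n => by
      rw [lintegral_congr fun b => show ‖mFourier (fun k => ∑ i, n (i, k)) b * c n‖ₑ = ENNReal.ofReal ‖c n‖ by
        rw [← ofReal_norm, norm_mul, Torus.norm_mFourier_apply, one_mul], lintegral_const, measure_univ, mul_one]
    refine ne_top_of_le_ne_top ?_ (ENNReal.tsum_le_tsum fun n => (hb n).le)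
    rw [← ENNReal.ofReal_tsum_of_nonneg (fun n => norm_nonneg _) hcs]
    exact ENNReal.ofReal_ne_top

/-- **A closed translation-invariant subspace contains the zero-momentum parts of its elements.** If
`V ⊆ L²((ℝ/ℤ)^{3N})` is a closed subspace with `T_b V ⊆ V` for all `b ∈ (ℝ/ℤ)³` and `η ∈ V`, then there is
`ζ ∈ V` with `⟪eₙ, ζ⟫ = 𝟙[∑ᵢ n(i,·) = 0] ⟪eₙ, η⟫` for all `n`; in particular `T_b ζ = ζ` for all `b` and
`⟪e₀, ζ⟫ = ⟪e₀, η⟫`. (`ζ` is the orthogonal projection of `η` onto the closed span of the zero-momentum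
characters; `ζ ⊥ Vᗮ` by the averaging identity, and `Vᗮᗮ = V`.) [cite: ReedSimonIV1978, §XIII.16] -/
theorem exists_invariant_mem_of_isClosed (V : Submodule ℂ (L2T N)) (hVc : IsClosed (V : Set (L2T N)))
    (hVT : ∀ (b : UnitAddTorus (Fin 3)) (η : L2T N), η ∈ V → translateLp b η ∈ V) {η : L2T N} (hη : η ∈ V) :
    ∃ ζ ∈ V, (∀ n : Fin N × Fin 3 → ℤ, ⟪(mFourierLp 2 n : L2T N), ζ⟫_ℂ =
        if (fun k => ∑ i, n (i, k)) = 0 then ⟪(mFourierLp 2 n : L2T N), η⟫_ℂ else 0) ∧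
      (∀ b : UnitAddTorus (Fin 3), translateLp b ζ = ζ) := by
  -- the closed span of the zero-momentum characters and the projection `ζ` of `η` onto it
  set K : Submodule ℂ (L2T N) := (Submodule.span ℂ (Set.range fun n : {n : Fin N × Fin 3 → ℤ //
    (fun k => ∑ i, n (i, k)) = 0} => (mFourierLp 2 n.1 : L2T N))).topologicalClosure with hK
  haveI : CompleteSpace K := (Submodule.isClosed_topologicalClosure _).completeSpace_coe
  set ζ : L2T N := K.starProjection η with hζ
  have hζK : ζ ∈ K := K.starProjection_apply_mem η
  -- Fourier coefficients of `ζ`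
  have hcoef : ∀ n : Fin N × Fin 3 → ℤ, ⟪(mFourierLp 2 n : L2T N), ζ⟫_ℂ =
      if (fun k => ∑ i, n (i, k)) = 0 then ⟪(mFourierLp 2 n : L2T N), η⟫_ℂ else 0 := by
    intro n
    split_ifs with hn
    · have hmem : (mFourierLp 2 n : L2T N) ∈ K :=
        Submodule.le_topologicalClosure _ (Submodule.subset_span ⟨⟨n, hn⟩, rfl⟩)
      rw [hζ, ← Submodule.inner_starProjection_left_eq_right, Submodule.starProjection_eq_self_iff.2 hmem]
    · -- `K ⊥ eₙ`
      have hle : K ≤ (ℂ ∙ (mFourierLp 2 n : L2T N))ᗮ := by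
        refine Submodule.topologicalClosure_minimal _ (Submodule.span_le.2 ?_) (Submodule.isClosed_orthogonal _)
        rintro _ ⟨⟨m, hm⟩, rfl⟩
        rw [SetLike.mem_coe, Submodule.mem_orthogonal_singleton_iff_inner_right, orthonormal_iff_ite.1 orthonormal_mFourier,
          if_neg]
        rintro rfl
        exact hn hm
      exact (Submodule.mem_orthogonal_singleton_iff_inner_right.1 (hle hζK))
  refine ⟨ζ, ?_, hcoef, ?_⟩
  · -- `ζ ∈ Vᗮᗮ = V` by the averaging identity
    haveI : CompleteSpace V := hVc.completeSpace_coe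
    rw [← Submodule.orthogonal_orthogonal V]
    refine (Submodule.mem_orthogonal _ _).2 fun ξ hξ => ?_
    have h1 : ⟪ξ, ζ⟫_ℂ = ∫ b, ⟪ξ, translateLp b η⟫_ℂ := by
      rw [integral_inner_translateLp, ← (hasSum_conj_inner_mul_inner ξ ζ).tsum_eq]
      refine tsum_congr fun n => ?_
      rw [hcoef n]
      split_ifs
      · rfl
      · rw [mul_zero]
    rw [h1]
    refine integral_eq_zero_of_ae (ae_of_all _ fun b => ?_)
    exact Submodule.inner_left_of_mem_orthogonal (hVT b η hη) hξ
  · rw [translateLp_eq_self_iff]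
    intro n hn
    rw [hcoef n, if_neg hn]

/-! ### The mean `⟪e₀, η⟫ = ∫ η` and non-negative classes -/

/-- The zero Fourier coefficient is the mean: `⟪e₀, η⟫ = ∫ η`. [folklore] -/
theorem inner_mFourierLp_zero_eq_integral (η : L2T N) :
    ⟪(mFourierLp 2 (0 : Fin N × Fin 3 → ℤ) : L2T N), η⟫_ℂ = ∫ t, (η : UnitAddTorus (Fin N × Fin 3) → ℂ) t := by
  rw [HaarTorus.inner_mFourierLp_eq_mFourierCoeff, mFourierCoeff]
  simp only [neg_zero, mFourier_zero, ContinuousMap.one_apply, one_smul]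

/-- **A non-zero class has a modulus of positive mean**: `⟪e₀, |η|⟫ = ∫ |η| > 0` for `η ≠ 0`, so that the
zero-momentum part of `|η|` does not vanish. [folklore] -/
theorem inner_mFourierLp_zero_absLp_ne_zero {η : L2T N} (hη : η ≠ 0) :
    ⟪(mFourierLp 2 (0 : Fin N × Fin 3 → ℤ) : L2T N), absLp η⟫_ℂ ≠ 0 := by
  have hint : Integrable (fun t => ‖(η : UnitAddTorus (Fin N × Fin 3) → ℂ) t‖) volume :=
    ((Lp.memLp η).integrable one_le_two).norm
  rw [inner_mFourierLp_zero_eq_integral, integral_congr_ae (coeFn_absLp η), integral_complex_ofReal, Ne,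
    Complex.ofReal_eq_zero, integral_eq_zero_iff_of_nonneg (fun t => norm_nonneg _) hint]
  intro h0
  refine hη (Lp.eq_zero_iff_ae_eq_zero.2 ?_)
  filter_upwards [h0] with t ht
  exact norm_eq_zero.1 ht

end Literature.MathematicalPhysics.QuantumManyBody.BoseGas
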